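import Literature.Computability.MetaComplexity.GGM
import Literature.Computability.MetaComplexity.HeuristicClassesProofs
import Literature.Computability.Cryptography.OracleGames
import Literature.Computability.Complexity.OracleProofs
import HarnessLib

/-!
# Tools for the uniform `MCSP` distinguisher: one-query adversaries and coin parsing (proofs)

Part of the proof architecture of the named fact `AllenderEtAl2006_MCSP_universalInverter`
(`MCSPUniversalInverter.lean`; Allender–Buhrman–Koucký–van Melkebeek–Ronneburger 2006, Thm. 45
with §4.2). The distinguisher `M^L` of the printed proof of Thm. 45 (p. 24 of the author version:
"a probabilistic oracle machine `M` using `L` that distinguishes `G_y` from the uniform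
distribution", obtained "as in [RR97]") computes ONE string from its input and coins — the truth
table of a randomly chosen hybrid of the GGM tree of `G_y`, the challenge planted at a random
node — and asks the oracle `L` about it. This file supplies the machine-free tools for analysing
such a machine in the tree's model of PPT oracle adversaries (`Cryptography/OracleGames.lean`):

* `exists_oracleAdversary_of_mem_FP` — **one-query adversaries**: for `f ∈ FP`, a language `A`
  and any coin polynomial `c` there is a PPT oracle adversary `M` with `c(|w|)` coins whose output
  law with oracle `A` on input `w` is the law of `[f ⟨w, r⟩ ∈ A]`, `r ∈ {0,1}^{c(|w|)}` uniform
  (the Cook reduction of `f⁻¹(A)` to `A`, `PolyTimeKarpReducible.turing_holds`, run on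
  `⟨w, r⟩`);
* `toReal_map_uniform_vector_apply`, `map_uniform_vector_take` — output laws of functions of
  uniform coin vectors as counting probabilities; a function of a prefix of the coins
  (`map_take_uniformOfFintype_vector`);
* `coinParse_injective`, `coinParse_bijective` — the parsing of `k + ℓ + 2^{k+1} ℓ` coins into a
  step number `i < 2ᵏ` (first `k` bits, via `boolFunEquivFin`), a root label `x ∈ {0,1}^ℓ` and a
  table of fresh labels `ω : Fin 2ᵏ → Bool → {0,1}^ℓ` (block `(t, b)` at offset
  `k + ℓ + (2t + b) ℓ`) is a bijection onto `Fin 2ᵏ × Sample ({0,1}^ℓ) k` (the sample space of the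
  hybrid argument of `MetaComplexity/GGM.lean`), so uniform coins give a uniform step and sample;
* `halves_bijective`, `seed_bijective`, `ofFn_getD_toList` — likewise for the challenge
  `z ∈ {0,1}^{2ℓ}` read as its two halves, and for seeds.

Theorems only.

## References

* E. Allender et al., *Power from random strings*, SIAM J. Comput. 35(6) (2006)
  [AllenderEtAl2006]: proof of Thm. 45 (p. 24).
* A. A. Razborov, S. Rudich, *Natural proofs*, JCSS 55 (1997) [RazborovRudich1997]: proof of
  Thm. 4.1.
* S. Arora, B. Barak, *Computational Complexity: A Modern Approach*, CUP 2009 [AroraBarak2009]: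
  Def. 7.1 with §3.4 (probabilistic oracle machines as deterministic machines on random coins),
  proof of Thm. 9.17 (p. 228).
-/

namespace Literature.Computability.MetaComplexity

open _root_.Computability Complexity Cryptography Finset

/-! ### One-query adversaries from `FP` maps -/

/-- **One-query adversaries.** For `f ∈ FP`, a language `A` and a coin polynomial `c` there is a
PPT oracle adversary `M` (Boolean output, `c(|w|)` coins on input `w`) whose output law with
oracle `A` on input `w` is the law of `some [f ⟨w, r⟩ ∈ A]` for uniform `r ∈ {0,1}^{c(|w|)}`: the
Cook reduction deciding `f⁻¹(A) ∈ P^A` (`PolyTimeKarpReducible.turing_holds`: compute `f`, ask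
one query, output the answer) run on the pair `⟨w, r⟩` for `q(|⟨w, r⟩|)` rounds.
[cite: AroraBarak2009, Def. 7.1 with §3.4] [cite: AllenderEtAl2006, Thm. 45 (proof, p. 24)] -/
theorem exists_oracleAdversary_of_mem_FP {f : List Bool → List Bool} (hf : f ∈ FP)
    (A : Language Bool) (c : Polynomial ℕ) :
    ∃ M : OracleAdversary Bool, M.IsPPT encodingBoolBool ∧ M.coins = c ∧
      ∀ w : List Bool, M.outputPMF (Oracle.ofLanguage A) w =
        (PMF.uniformOfFintype (List.Vector Bool (c.eval w.length))).map
          fun r => some ((f ⁻¹' A).boolIndicator (boolPair w r.toList)) := by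
  have hK : PolyTimeKarpReducible (f ⁻¹' A) A :=
    polyTimeKarpReducible_iff.2 ⟨f, hf, fun x => Iff.rfl⟩
  obtain ⟨M₀, hM₀, q, hrun⟩ := PolyTimeKarpReducible.turing_holds hK
  refine ⟨⟨M₀, c, q.comp (2 * Polynomial.X + 2 + c)⟩, hM₀, rfl, fun w => ?_⟩
  rw [OracleAdversary.outputPMF_eq_map]
  refine congrFun (congrArg PMF.map (funext fun r => ?_)) _
  have hlen : (boolPair w r.toList).length = 2 * w.length + 2 + c.eval w.length := by simp
  have h1 := (hrun (boolPair w r.toList)).1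
  rw [hlen] at h1
  have hfuel : (q.comp (2 * Polynomial.X + 2 + c)).eval w.length =
      q.eval (2 * w.length + 2 + c.eval w.length) := by
    simp [Polynomial.eval_comp]
  change M₀.run _ ((q.comp (2 * Polynomial.X + 2 + c)).eval w.length) _ = _
  rw [hfuel, h1]

/-! ### Output laws of functions of uniform coin vectors -/

/-- The law of a function of a uniform coin vector, as a counting probability:
`Pr_v[F v = b] = #{v | F v = b} / 2ᴷ`. [folklore] [cite: AroraBarak2009, Def. 7.1] -/
theorem toReal_map_uniform_vector_apply {K : ℕ} {γ : Type} [DecidableEq γ]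
    (F : List Bool → γ) (b : γ) :
    (((PMF.uniformOfFintype (List.Vector Bool K)).map fun r => F r.toList) b).toReal =
      (#{v : List.Vector Bool K | F v.toList = b} : ℝ) / 2 ^ K := by
  classical
  rw [← PMF.toOuterMeasure_apply_singleton ((PMF.uniformOfFintype _).map _) b,
    PMF.toOuterMeasure_map_apply, PMF.toOuterMeasure_uniformOfFintype_apply, ENNReal.toReal_div,
    ENNReal.toReal_natCast, ENNReal.toReal_natCast, card_vector, Fintype.card_bool,
    Fintype.card_subtype]
  push_cast
  congr 2
  congr 1
  ext v
  simp

/-- A function of the first `K ≤ c` coins of a uniform `c`-bit vector has the law of the same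
function of a uniform `K`-bit vector (`map_take_uniformOfFintype_vector`). [folklore]
[cite: AroraBarak2009, Def. 7.1] -/
theorem map_uniform_vector_take {c K : ℕ} (hK : K ≤ c) {γ : Type} (F : List Bool → γ) :
    (PMF.uniformOfFintype (List.Vector Bool c)).map (fun r => F (r.toList.take K)) =
      (PMF.uniformOfFintype (List.Vector Bool K)).map fun v => F v.toList := by
  rw [show (fun r : List.Vector Bool c => F (r.toList.take K)) = F ∘ fun r => r.toList.take K
      from rfl, ← PMF.map_comp, map_take_uniformOfFintype_vector hK, PMF.map_comp]
  rfl

/-! ### Parsing coins into a step number and a sample of fresh labels -/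

/-- `cond b 1 0 < 2` and it recovers `q` from `q / 2` and the parity bit. [folklore] -/
private theorem two_mul_div_add_cond (q : ℕ) :
    2 * (q / 2) + cond (decide (q % 2 = 1)) 1 0 = q := by
  rcases Nat.mod_two_eq_zero_or_one q with h | h
  · simp [h]; omega
  · simp [h]; omega

/-- **The coin parsing is injective.** Reading `K = k + ℓ + 2^{k+1} ℓ` coins `v` as: the step
number `boolFunEquivFin k (v₀ … v_{k−1})`, the root label `(v_k … v_{k+ℓ−1})`, and the table of
fresh labels whose block `(t, b)` (`t < 2ᵏ`, `b` a bit) is `(v_{k+ℓ+(2t+b)ℓ+j})_{j<ℓ}`, determines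
`v`. [folklore] [cite: AroraBarak2009, proof of Thm. 9.17 p. 228] -/
theorem coinParse_injective (k ℓ : ℕ) :
    Function.Injective fun v : List.Vector Bool (k + ℓ + 2 ^ (k + 1) * ℓ) =>
      ((boolFunEquivFin k fun t => v.toList.getD t false),
        ((fun j : Fin ℓ => v.toList.getD (k + j) false),
          fun (t : Fin (2 ^ k)) (b : Bool) (j : Fin ℓ) =>
            v.toList.getD (k + ℓ + (2 * t + cond b 1 0) * ℓ + j) false)) := by
  intro v v' h
  simp only [Prod.mk.injEq] at h
  obtain ⟨hi, hx, hω⟩ := h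
  have hi' := (boolFunEquivFin k).injective hi
  -- all coin positions agree
  have hget : ∀ t, t < k + ℓ + 2 ^ (k + 1) * ℓ →
      v.toList.getD t false = v'.toList.getD t false := by
    intro t ht
    by_cases h1 : t < k
    · exact congrFun hi' ⟨t, h1⟩
    by_cases h2 : t < k + ℓ
    · have := congrFun hx ⟨t - k, by omega⟩
      simp only at this
      rwa [show k + (t - k) = t by omega] at this
    · -- inside the table of fresh labels
      have hℓ : 0 < ℓ := by
        rcases Nat.eq_zero_or_pos ℓ with h0 | h0
        · subst h0; simp at ht; omega
        · exact h0
      set u := t - (k + ℓ) with hu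
      have hult : u < 2 ^ (k + 1) * ℓ := by omega
      have hq : u / ℓ < 2 ^ (k + 1) := Nat.div_lt_iff_lt_mul hℓ |>.2 (by linarith)
      have hj : u % ℓ < ℓ := Nat.mod_lt u hℓ
      have ht' : u / ℓ / 2 < 2 ^ k := by
        rw [Nat.div_lt_iff_lt_mul two_pos]
        simpa [pow_succ] using hq
      have h3 := congrFun (congrFun (congrFun hω ⟨u / ℓ / 2, ht'⟩) (decide (u / ℓ % 2 = 1)))
        ⟨u % ℓ, hj⟩
      simp only at h3
      have hpos : k + ℓ + (2 * (u / ℓ / 2) + cond (decide (u / ℓ % 2 = 1)) 1 0) * ℓ + u % ℓ = t := by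
        rw [two_mul_div_add_cond]
        have := Nat.div_add_mod' u ℓ
        omega
      rwa [hpos] at h3
  -- hence the vectors agree
  apply List.Vector.ext
  intro i
  have h1 := hget i i.isLt
  rw [List.getD_eq_getElem _ _ (by simp), List.getD_eq_getElem _ _ (by simp)] at h1
  simpa [List.Vector.get_eq_get_toList] using h1

/-- **Uniform coins parse to a uniform step number and sample**: the parsing map of
`coinParse_injective` is a bijection from `{0,1}^{k+ℓ+2^{k+1}ℓ}` onto
`Fin 2ᵏ × Sample ({0,1}^ℓ) k` (injective between finite sets of equal size
`2^{k+ℓ+2^{k+1}ℓ} = 2ᵏ · 2^ℓ · (2^{2ℓ})^{2ᵏ}`). [folklore]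
[cite: AroraBarak2009, proof of Thm. 9.17 p. 228] -/
theorem coinParse_bijective (k ℓ : ℕ) :
    Function.Bijective fun v : List.Vector Bool (k + ℓ + 2 ^ (k + 1) * ℓ) =>
      ((boolFunEquivFin k fun t => v.toList.getD t false),
        ((fun j : Fin ℓ => v.toList.getD (k + j) false),
          fun (t : Fin (2 ^ k)) (b : Bool) (j : Fin ℓ) =>
            v.toList.getD (k + ℓ + (2 * t + cond b 1 0) * ℓ + j) false)) := by
  refine (Fintype.bijective_iff_injective_and_card _).2 ⟨coinParse_injective k ℓ, ?_⟩
  simp only [card_vector, Fintype.card_bool, Fintype.card_prod, Fintype.card_fin,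
    Fintype.card_fun]
  rw [← pow_mul, ← pow_mul, ← pow_add, ← pow_add]
  congr 1
  ring

/-! ### The challenge as two halves; seeds -/

/-- **Reading a `2ℓ`-bit challenge as its two `ℓ`-bit halves is a bijection** onto
`Bool → {0,1}^ℓ` (half `b`, position `j` is bit `cond b (ℓ + j) j`). [folklore]
[cite: AroraBarak2009, proof of Thm. 9.17 p. 227 ("G₀(x) the first n bits, G₁(x) the last n bits")] -/
theorem halves_bijective (ℓ : ℕ) :
    Function.Bijective fun z : List.Vector Bool (2 * ℓ) =>
      fun (b : Bool) (j : Fin ℓ) => z.toList.getD (cond b (ℓ + j) j) false := by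
  refine (Fintype.bijective_iff_injective_and_card _).2 ⟨fun z z' h => ?_, ?_⟩
  · have hget : ∀ t, t < 2 * ℓ → z.toList.getD t false = z'.toList.getD t false := by
      intro t ht
      by_cases h1 : t < ℓ
      · have := congrFun (congrFun h false) ⟨t, h1⟩
        simpa using this
      · have := congrFun (congrFun h true) ⟨t - ℓ, by omega⟩
        simp only [cond_true] at this
        rwa [show ℓ + (t - ℓ) = t by omega] at this
    apply List.Vector.ext
    intro i
    have h1 := hget i i.isLt
    rw [List.getD_eq_getElem _ _ (by simp), List.getD_eq_getElem _ _ (by simp)] at h1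
    simpa [List.Vector.get_eq_get_toList] using h1
  · simp only [card_vector, Fintype.card_bool, Fintype.card_fun, Fintype.card_fin]
    rw [← pow_mul, mul_comm]

/-- **Reading an `ℓ`-bit seed as a point of `{0,1}^ℓ` is a bijection.** [folklore] -/
theorem seed_bijective (ℓ : ℕ) :
    Function.Bijective fun s : List.Vector Bool ℓ => fun j : Fin ℓ => s.toList.getD j false := by
  refine (Fintype.bijective_iff_injective_and_card _).2 ⟨fun s s' h => ?_, by simp [card_vector]⟩
  apply List.Vector.ext
  intro i
  have h1 := congrFun h ⟨i, i.isLt⟩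
  simp only at h1
  rw [List.getD_eq_getElem _ _ (by simp), List.getD_eq_getElem _ _ (by simp)] at h1
  simpa [List.Vector.get_eq_get_toList] using h1

/-- The seed is recovered from its positional reading: `ofFn (j ↦ s[j]) = s`. [folklore] -/
theorem ofFn_getD_toList {ℓ : ℕ} (s : List.Vector Bool ℓ) :
    List.ofFn (fun j : Fin ℓ => s.toList.getD j false) = s.toList := by
  apply List.ext_getElem
  · simp
  · intro i h1 h2
    rw [List.getElem_ofFn, List.getD_eq_getElem _ _ h2]

end Literature.Computability.MetaComplexity
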